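import Literature.AlgebraicGeometry.HodgeTheory.EigenspaceDualityPairing
import HarnessLib

/-!
# The duality block: an isometry's matrix on `H(ζ^(p−a))` is `G⁻¹ · (M')ᵀ · G` with `M'` its inverse's
# matrix on `H(ζ^a)` and `G` the Gram matrix of the perfect pairing `B_ℂ : H(ζ^a) × H(ζ^(p−a)) → ℂ`
# — lane D, hole S6 (the polynomial formula for the dual blocks of the section)

Family `hodge`, layer `Literature/AlgebraicGeometry/HodgeTheory`. THEOREMS only, for crux K1 of
`Summits/HodgeConjecture/HodgeConjecture/Theses/CyclicUnitaryPowers.lean` (lane D glue, hole S6).  For `B`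
symmetric non-degenerate and `τ` a `B`-isometry with `τ^p = 1`: the restricted pairing
`(B ⊗ ℂ)|H(ζ^a) × H(ζ^(p−a))` is `Nondegenerate` (`1 ≤ a < p`), so its Gram matrix `G` in bases with a common index
type is invertible; and for a `B_ℂ`-isometry `θ` of `V ⊗ ℂ` preserving `H(ζ^a)` (together with `θ⁻¹`) and
`H(ζ^(p−a))`, the matrices `N` of `θ|H(ζ^(p−a))` and `M'` of `θ⁻¹|H(ζ^a)` satisfy `G N = (M')ᵀ G`, i.e.
`N = G⁻¹ (M')ᵀ G` — a polynomial expression in the entries of `θ⁻¹|H(ζ^a)` ("`H(μ̄) ≅ H(μ)^*` via the cup product").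
Written by the prover seat `hodge-nonav-prover-Ax`.

## References
* [CarlsonToledo1999] J. A. Carlson, D. Toledo, Duke Math. J. 97 (1999), §2 (p. 5), §5 (p. 11).
-/

noncomputable section

open Module Literature.AlgebraicGeometry.Motives
open scoped TensorProduct Matrix

namespace Literature.AlgebraicGeometry.HodgeTheory

universe v

variable {V : Type v} [AddCommGroup V] [Module ℚ V] [Module.Finite ℚ V]

/-- **The pairing `B_ℂ : H(ζ^a) × H(ζ^(p−a)) → ℂ` is non-degenerate** (`1 ≤ a < p`).
[cite: CarlsonToledo1999, §2 (p. 5)] -/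
theorem nondegenerate_baseChange_domRestrict_eigenspace {τ : V →ₗ[ℚ] V} {p : ℕ} (hτ : τ ^ p = 1) {ζ : ℂ}
    (hζ : IsPrimitiveRoot ζ p) (hp : 0 < p) {B : LinearMap.BilinForm ℚ V} (hB : B.IsSymm) (hBn : B.Nondegenerate)
    (hτB : ∀ v w, B (τ v) (τ w) = B v w) {a : ℕ} (ha1 : 1 ≤ a) (hap : a < p) :
    ((B.baseChange ℂ).domRestrict₁₂ (Module.End.eigenspace (τ.baseChange ℂ) (ζ ^ a))
      (Module.End.eigenspace (τ.baseChange ℂ) (ζ ^ (p - a)))).Nondegenerate := by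
  refine ⟨fun x hx => ?_, fun y hy => ?_⟩
  · exact Subtype.ext (eq_zero_of_mem_eigenspace_of_forall_baseChange_eq_zero hτ hζ hp hB hBn hτB ha1 hap x.2
      fun y hy' => by simpa [LinearMap.domRestrict₁₂_apply] using hx ⟨y, hy'⟩)
  · have hpa1 : 1 ≤ p - a := by omega
    have hpap : p - a < p := by omega
    refine Subtype.ext (eq_zero_of_mem_eigenspace_of_forall_baseChange_eq_zero hτ hζ hp hB hBn hτB hpa1 hpap y.2
      fun x hx' => ?_)
    rw [Nat.sub_sub_self hap.le] at hx'
    have hs := (LinearMap.BilinForm.IsSymm.baseChange (A := ℂ) (LinearMap.BilinForm.isSymm_iff.1 hB)).eq (y : ℂ ⊗[ℚ] V) x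
    rw [RingHom.id_apply] at hs
    rw [hs]
    simpa [LinearMap.domRestrict₁₂_apply] using hy ⟨x, hx'⟩

variable {ι : Type*} [Fintype ι] [DecidableEq ι]

/-- The Gram matrix of the pairing `H(ζ^a) × H(ζ^(p−a)) → ℂ` in bases with a common index type is invertible.
[cite: CarlsonToledo1999, §2 (p. 5)] -/
theorem det_toMatrix₂_eigenspace_pairing_ne_zero {τ : V →ₗ[ℚ] V} {p : ℕ} (hτ : τ ^ p = 1) {ζ : ℂ}
    (hζ : IsPrimitiveRoot ζ p) (hp : 0 < p) {B : LinearMap.BilinForm ℚ V} (hB : B.IsSymm) (hBn : B.Nondegenerate)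
    (hτB : ∀ v w, B (τ v) (τ w) = B v w) {a : ℕ} (ha1 : 1 ≤ a) (hap : a < p)
    (ca : Module.Basis ι ℂ (Module.End.eigenspace (τ.baseChange ℂ) (ζ ^ a)))
    (cb : Module.Basis ι ℂ (Module.End.eigenspace (τ.baseChange ℂ) (ζ ^ (p - a)))) :
    (LinearMap.toMatrix₂ ca cb ((B.baseChange ℂ).domRestrict₁₂ (Module.End.eigenspace (τ.baseChange ℂ) (ζ ^ a))
      (Module.End.eigenspace (τ.baseChange ℂ) (ζ ^ (p - a))))).det ≠ 0 :=
  Matrix.nondegenerate_iff_det_ne_zero.1 ((LinearMap.nondegenerate_toMatrix₂_iff ca cb).2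
    (nondegenerate_baseChange_domRestrict_eigenspace hτ hζ hp hB hBn hτB ha1 hap))

omit [Module.Finite ℚ V] in
/-- **`G · N = (M')ᵀ · G`**: for a `B_ℂ`-isometry `θ` of `V ⊗ ℂ` mapping `H(ζ^(p−a))` into itself and whose inverse
maps `H(ζ^a)` into itself, the matrix `N` of `θ|H(ζ^(p−a))`, the matrix `M'` of `θ⁻¹|H(ζ^a)` and the Gram matrix `G`
satisfy `G N = (M')ᵀ G` (`B_ℂ(x, θ y) = B_ℂ(θ⁻¹ x, y)`). [cite: CarlsonToledo1999, §2 (p. 5)] -/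
theorem toMatrix₂_mul_toMatrix_restrict_eq {τ : V →ₗ[ℚ] V} {p a : ℕ} {ζ : ℂ} {B : LinearMap.BilinForm ℚ V}
    (ca : Module.Basis ι ℂ (Module.End.eigenspace (τ.baseChange ℂ) (ζ ^ a)))
    (cb : Module.Basis ι ℂ (Module.End.eigenspace (τ.baseChange ℂ) (ζ ^ (p - a))))
    {θ : ℂ ⊗[ℚ] V ≃ₗ[ℂ] ℂ ⊗[ℚ] V} (hθ : ∀ x y, B.baseChange ℂ (θ x) (θ y) = B.baseChange ℂ x y)
    (hb : Set.MapsTo (θ : ℂ ⊗[ℚ] V →ₗ[ℂ] ℂ ⊗[ℚ] V) (Module.End.eigenspace (τ.baseChange ℂ) (ζ ^ (p - a)))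
      (Module.End.eigenspace (τ.baseChange ℂ) (ζ ^ (p - a))))
    (ha' : Set.MapsTo ((θ⁻¹ : ℂ ⊗[ℚ] V ≃ₗ[ℂ] ℂ ⊗[ℚ] V) : ℂ ⊗[ℚ] V →ₗ[ℂ] ℂ ⊗[ℚ] V)
      (Module.End.eigenspace (τ.baseChange ℂ) (ζ ^ a)) (Module.End.eigenspace (τ.baseChange ℂ) (ζ ^ a))) :
    LinearMap.toMatrix₂ ca cb ((B.baseChange ℂ).domRestrict₁₂ _ _) *
        LinearMap.toMatrix cb cb ((θ : ℂ ⊗[ℚ] V →ₗ[ℂ] ℂ ⊗[ℚ] V).restrict hb) =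
      (LinearMap.toMatrix ca ca (((θ⁻¹ : ℂ ⊗[ℚ] V ≃ₗ[ℂ] ℂ ⊗[ℚ] V) : ℂ ⊗[ℚ] V →ₗ[ℂ] ℂ ⊗[ℚ] V).restrict ha'))ᵀ *
        LinearMap.toMatrix₂ ca cb ((B.baseChange ℂ).domRestrict₁₂ _ _) := by
  rw [← LinearMap.toMatrix₂_compl₂, ← LinearMap.toMatrix₂_comp]
  congr 1
  refine LinearMap.ext fun x => LinearMap.ext fun y => ?_
  simp only [LinearMap.compl₂_apply, LinearMap.comp_apply, LinearMap.domRestrict₁₂_apply, LinearMap.restrict_apply]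
  -- `B_ℂ(x, θ y) = B_ℂ(θ (θ⁻¹ x), θ y) = B_ℂ(θ⁻¹ x, y)`
  conv_lhs => rw [show ((x : ℂ ⊗[ℚ] V)) = θ ((θ⁻¹ : ℂ ⊗[ℚ] V ≃ₗ[ℂ] ℂ ⊗[ℚ] V) x) from
    (LinearEquiv.apply_symm_apply θ x).symm]
  rw [LinearEquiv.coe_coe, hθ]
  rfl

/-- **The dual block formula `N = G⁻¹ · (M')ᵀ · G`.** [cite: CarlsonToledo1999, §2 (p. 5)] -/
theorem toMatrix_restrict_dual_eq {τ : V →ₗ[ℚ] V} {p : ℕ} (hτ : τ ^ p = 1) {ζ : ℂ} (hζ : IsPrimitiveRoot ζ p)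
    (hp : 0 < p) {B : LinearMap.BilinForm ℚ V} (hB : B.IsSymm) (hBn : B.Nondegenerate)
    (hτB : ∀ v w, B (τ v) (τ w) = B v w) {a : ℕ} (ha1 : 1 ≤ a) (hap : a < p)
    (ca : Module.Basis ι ℂ (Module.End.eigenspace (τ.baseChange ℂ) (ζ ^ a)))
    (cb : Module.Basis ι ℂ (Module.End.eigenspace (τ.baseChange ℂ) (ζ ^ (p - a))))
    {θ : ℂ ⊗[ℚ] V ≃ₗ[ℂ] ℂ ⊗[ℚ] V} (hθ : ∀ x y, B.baseChange ℂ (θ x) (θ y) = B.baseChange ℂ x y)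
    (hb : Set.MapsTo (θ : ℂ ⊗[ℚ] V →ₗ[ℂ] ℂ ⊗[ℚ] V) (Module.End.eigenspace (τ.baseChange ℂ) (ζ ^ (p - a)))
      (Module.End.eigenspace (τ.baseChange ℂ) (ζ ^ (p - a))))
    (ha' : Set.MapsTo ((θ⁻¹ : ℂ ⊗[ℚ] V ≃ₗ[ℂ] ℂ ⊗[ℚ] V) : ℂ ⊗[ℚ] V →ₗ[ℂ] ℂ ⊗[ℚ] V)
      (Module.End.eigenspace (τ.baseChange ℂ) (ζ ^ a)) (Module.End.eigenspace (τ.baseChange ℂ) (ζ ^ a))) :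
    LinearMap.toMatrix cb cb ((θ : ℂ ⊗[ℚ] V →ₗ[ℂ] ℂ ⊗[ℚ] V).restrict hb) =
      (LinearMap.toMatrix₂ ca cb ((B.baseChange ℂ).domRestrict₁₂ _ _))⁻¹ *
        (LinearMap.toMatrix ca ca (((θ⁻¹ : ℂ ⊗[ℚ] V ≃ₗ[ℂ] ℂ ⊗[ℚ] V) : ℂ ⊗[ℚ] V →ₗ[ℂ] ℂ ⊗[ℚ] V).restrict ha'))ᵀ *
        LinearMap.toMatrix₂ ca cb ((B.baseChange ℂ).domRestrict₁₂ _ _) := by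
  have hG := det_toMatrix₂_eigenspace_pairing_ne_zero hτ hζ hp hB hBn hτB ha1 hap ca cb
  have h := toMatrix₂_mul_toMatrix_restrict_eq ca cb hθ hb ha'
  have hGu : IsUnit (LinearMap.toMatrix₂ ca cb ((B.baseChange ℂ).domRestrict₁₂
      (Module.End.eigenspace (τ.baseChange ℂ) (ζ ^ a)) (Module.End.eigenspace (τ.baseChange ℂ) (ζ ^ (p - a))))).det :=
    isUnit_iff_ne_zero.2 hG
  calc LinearMap.toMatrix cb cb ((θ : ℂ ⊗[ℚ] V →ₗ[ℂ] ℂ ⊗[ℚ] V).restrict hb)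
      = (LinearMap.toMatrix₂ ca cb ((B.baseChange ℂ).domRestrict₁₂ _ _))⁻¹ *
          (LinearMap.toMatrix₂ ca cb ((B.baseChange ℂ).domRestrict₁₂ _ _) *
            LinearMap.toMatrix cb cb ((θ : ℂ ⊗[ℚ] V →ₗ[ℂ] ℂ ⊗[ℚ] V).restrict hb)) := by
        rw [Matrix.nonsing_inv_mul_cancel_left _ _ hGu]
    _ = _ := by rw [h, Matrix.mul_assoc]

end Literature.AlgebraicGeometry.HodgeTheory

end
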